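import Summits.Ventures.PercRepro2.CaseOneLeafDelete
import Summits.Ventures.PercRepro2.CaseOneStarMain
import Summits.Ventures.PercRepro2.CaseOneStarMainQt
import Summits.Ventures.PercRepro2.CaseOneStarMainI
import Summits.Ventures.PercRepro2.CaseOneStarMainQtI

/-!
# `(i)`, `(ii)` and `(J1₁)` for `a₃` pendant at a marked-star vertex
(blind cell PercRepro2, p1 g16; S5 §2.1 (K9) (j) / (q): the pendant lemma closed at a marked star)

The pendant lemma (K8, `zSplitII_of_leaf_at` / `zSplitI_of_leaf_at`) reads
`(ii)(a₃) = w · [(1 − w) · (ii-Q)(u) + w · (ii)(u)]` (and likewise `(i)`) for `a₃` a leaf at `u` with edge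
weight `w`; at a vertex `u` adjacent exactly to `a₁, a₂, o, b` all four brackets are theorems
(`zSplitII_of_markedStar`, `zSplitIIQ_of_markedStar`, `zSplitI_of_markedStar`, `zSplitIQ_of_markedStar`) —
in the graph `G − e₀` (the structural predicate `IsMarkedStarAt` counts the pendant edge), whence in `G`
by the leaf-deletion transfer (`CaseOneLeafDelete.lean`). So **`zSplitII_of_leaf_markedStar`**,
**`zSplitI_of_leaf_markedStar`**, **`jOneOne_of_leaf_markedStar`**: `(ii)`, `(RV)`, `(i)` and `(J1₁)` for
every finite graph, every weight vector and every `a₃` of degree one whose neighbour `u` is adjacent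
exactly to the four marks; `IsPendantStarAt` is the five-edge description of this class in `G` itself. -/

namespace Summit.Ventures.PercRepro2

namespace CaseOne

section Pendant
variable {V : Type*} {E : Type*} [Fintype E] [DecidableEq E] [Fintype V] [DecidableEq V]
  {R : Type*} [Field R] [LinearOrder R] [IsStrictOrderedRing R]
variable {ends : E → Sym2 V} {o a₁ a₂ b u a₃ : V} {e₀ : E}

/-- **`(ii)` for `a₃` pendant at a marked-star vertex**: `a₃` is a leaf at `u` (edge `e₀`), and in `G − e₀`
the vertex `u` is adjacent exactly to `a₁, a₂, o, b`; every weight vector (the weight of `e₀` included). -/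
theorem zSplitII_of_leaf_markedStar (p : E → R) (hp : IsProbVec p) (hl : IsLeafAt ends u a₃ e₀)
    (ho : o ≠ a₃) (h1 : a₁ ≠ a₃) (h2 : a₂ ≠ a₃) (hb : b ≠ a₃) {e₁ e₂ eo eb : {e : E // e ≠ e₀}}
    (h : IsMarkedStarAt (restrictEnds ends e₀) o a₁ a₂ b u e₁ e₂ eo eb) :
    ZSplitII p ends o a₁ a₂ a₃ b :=
  zSplitII_of_leaf_at p hp hl o a₁ a₂ b ho h1 h2 hb
    (zSplitII_of_restrict p hl ho h1 h2 hl.ne hb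
      (zSplitII_of_markedStar (restrictW p e₀) (IsProbVec.restrictW hp e₀) h))
    (zSplitIIQ_of_restrict p hl ho h1 h2 hl.ne hb
      (zSplitIIQ_of_markedStar (restrictW p e₀) (IsProbVec.restrictW hp e₀) h))

/-- **`(i)` for `a₃` pendant at a marked-star vertex**: the `(i)`-side of the same composition. -/
theorem zSplitI_of_leaf_markedStar (p : E → R) (hp : IsProbVec p) (hl : IsLeafAt ends u a₃ e₀)
    (ho : o ≠ a₃) (h1 : a₁ ≠ a₃) (h2 : a₂ ≠ a₃) (hb : b ≠ a₃) {e₁ e₂ eo eb : {e : E // e ≠ e₀}}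
    (h : IsMarkedStarAt (restrictEnds ends e₀) o a₁ a₂ b u e₁ e₂ eo eb) :
    ZSplitI p ends o a₁ a₂ a₃ b :=
  zSplitI_of_leaf_at p hp hl o a₁ a₂ b ho h1 h2 hb
    (zSplitI_of_restrict p hl ho h1 h2 hl.ne hb
      (zSplitI_of_markedStar (restrictW p e₀) (IsProbVec.restrictW hp e₀) h))
    (zSplitIQ_of_restrict p hl ho h1 h2 hl.ne hb
      (zSplitIQ_of_markedStar (restrictW p e₀) (IsProbVec.restrictW hp e₀) h))

/-- **`(J1₁)` for `a₃` pendant at a marked-star vertex**: from `(i)` and `(ii)`. -/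
theorem jOneOne_of_leaf_markedStar (p : E → R) (hp : IsProbVec p) (hl : IsLeafAt ends u a₃ e₀)
    (ho : o ≠ a₃) (h1 : a₁ ≠ a₃) (h2 : a₂ ≠ a₃) (hb : b ≠ a₃) {e₁ e₂ eo eb : {e : E // e ≠ e₀}}
    (h : IsMarkedStarAt (restrictEnds ends e₀) o a₁ a₂ b u e₁ e₂ eo eb) :
    JOneOne p ends o a₁ a₂ a₃ b :=
  jOneOne_of_i_of_ii p ends o a₁ a₂ a₃ b (zSplitI_of_leaf_markedStar p hp hl ho h1 h2 hb h)
    (zSplitII_of_leaf_markedStar p hp hl ho h1 h2 hb h)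

/-- **`(RV)` for `a₃` pendant at a marked-star vertex** (when the required-vertex world has mass). -/
theorem rv_of_leaf_markedStar (p : E → R) (hp : IsProbVec p) (hl : IsLeafAt ends u a₃ e₀)
    (ho : o ≠ a₃) (h1 : a₁ ≠ a₃) (h2 : a₂ ≠ a₃) (hb : b ≠ a₃) {e₁ e₂ eo eb : {e : E // e ≠ e₀}}
    (h : IsMarkedStarAt (restrictEnds ends e₀) o a₁ a₂ b u e₁ e₂ eo eb)
    (hT : 0 < prob p (Tp ends a₁ a₂ a₃)) : RV p ends o a₁ a₂ a₃ b :=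
  (rv_iff_ii p ends o a₁ a₂ a₃ b hT).2 (zSplitII_of_leaf_markedStar p hp hl ho h1 h2 hb h)

end Pendant

/-! ## The five-edge description in `G` -/

section FiveEdges
variable {V : Type*} {E : Type*}

/-- **The pendant star**: `a₃` is a leaf at `u` through `e₀`, and the other edges at `u` are exactly
`e₁ = {a₁, u}`, `e₂ = {a₂, u}`, `eo = {o, u}`, `eb = {b, u}` (four distinct edges), with
`a₁, a₂, o, b ≠ u` and `≠ a₃`. -/
structure IsPendantStarAt (ends : E → Sym2 V) (o a₁ a₂ b u a₃ : V) (e₀ e₁ e₂ eo eb : E) : Prop where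
  /-- the leaf -/
  leaf : IsLeafAt ends u a₃ e₀
  /-- the edge to `a₁` -/
  ends_1 : ends e₁ = s(a₁, u)
  /-- the edge to `a₂` -/
  ends_2 : ends e₂ = s(a₂, u)
  /-- the edge to `o` -/
  ends_o : ends eo = s(o, u)
  /-- the edge to `b` -/
  ends_b : ends eb = s(b, u)
  /-- distinct edges -/
  ne_12 : e₁ ≠ e₂
  /-- distinct edges -/
  ne_1o : e₁ ≠ eo
  /-- distinct edges -/
  ne_1b : e₁ ≠ eb
  /-- distinct edges -/
  ne_2o : e₂ ≠ eo
  /-- distinct edges -/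
  ne_2b : e₂ ≠ eb
  /-- distinct edges -/
  ne_ob : eo ≠ eb
  /-- no other edge at `u` -/
  unique : ∀ e, u ∈ ends e → e = e₀ ∨ e = e₁ ∨ e = e₂ ∨ e = eo ∨ e = eb
  /-- `a₁ ≠ u` -/
  ne_a1 : a₁ ≠ u
  /-- `a₂ ≠ u` -/
  ne_a2 : a₂ ≠ u
  /-- `o ≠ u` -/
  ne_o : o ≠ u
  /-- `b ≠ u` -/
  ne_b : b ≠ u
  /-- `a₁ ≠ a₃` -/
  ne_a1' : a₁ ≠ a₃
  /-- `a₂ ≠ a₃` -/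
  ne_a2' : a₂ ≠ a₃
  /-- `o ≠ a₃` -/
  ne_o' : o ≠ a₃
  /-- `b ≠ a₃` -/
  ne_b' : b ≠ a₃

variable {ends : E → Sym2 V} {o a₁ a₂ b u a₃ : V} {e₀ e₁ e₂ eo eb : E}

/-- An edge `{x, u}` with `x ≠ a₃` is not the leaf edge `{u, a₃}`. -/
lemma ne_leaf_edge_of_ends (hl : IsLeafAt ends u a₃ e₀) {e : E} {x : V} (he : ends e = s(x, u))
    (hx : x ≠ a₃) : e ≠ e₀ := by
  rintro rfl
  rw [hl.ends_eq] at he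
  rcases Sym2.eq_iff.1 he with ⟨_, h⟩ | ⟨_, h⟩
  · exact hl.ne h.symm
  · exact hx h.symm

/-- In `G − e₀` the vertex `u` of a pendant star is a marked star. -/
theorem IsPendantStarAt.markedStar (h : IsPendantStarAt ends o a₁ a₂ b u a₃ e₀ e₁ e₂ eo eb) :
    IsMarkedStarAt (restrictEnds ends e₀) o a₁ a₂ b u
      ⟨e₁, ne_leaf_edge_of_ends h.leaf h.ends_1 h.ne_a1'⟩ ⟨e₂, ne_leaf_edge_of_ends h.leaf h.ends_2 h.ne_a2'⟩
      ⟨eo, ne_leaf_edge_of_ends h.leaf h.ends_o h.ne_o'⟩ ⟨eb, ne_leaf_edge_of_ends h.leaf h.ends_b h.ne_b'⟩ where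
  ends_1 := h.ends_1
  ends_2 := h.ends_2
  ends_o := h.ends_o
  ends_b := h.ends_b
  ne_12 := fun h' => h.ne_12 (congrArg Subtype.val h')
  ne_1o := fun h' => h.ne_1o (congrArg Subtype.val h')
  ne_1b := fun h' => h.ne_1b (congrArg Subtype.val h')
  ne_2o := fun h' => h.ne_2o (congrArg Subtype.val h')
  ne_2b := fun h' => h.ne_2b (congrArg Subtype.val h')
  ne_ob := fun h' => h.ne_ob (congrArg Subtype.val h')
  unique := by
    rintro ⟨e, he0⟩ hu
    rcases h.unique e hu with rfl | rfl | rfl | rfl | rfl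
    · exact absurd rfl he0
    · exact Or.inl rfl
    · exact Or.inr (Or.inl rfl)
    · exact Or.inr (Or.inr (Or.inl rfl))
    · exact Or.inr (Or.inr (Or.inr rfl))
  ne_a1 := h.ne_a1
  ne_a2 := h.ne_a2
  ne_o := h.ne_o
  ne_b := h.ne_b

end FiveEdges

section PendantFive
variable {V : Type*} {E : Type*} [Fintype E] [DecidableEq E] [Fintype V] [DecidableEq V]
  {R : Type*} [Field R] [LinearOrder R] [IsStrictOrderedRing R]
variable {ends : E → Sym2 V} {o a₁ a₂ b u a₃ : V} {e₀ e₁ e₂ eo eb : E}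

/-- **`(ii)` for the pendant star in `G`**: `a₃` a leaf at `u`, `u` adjacent to `a₃, a₁, a₂, o, b` and
nothing else; every finite graph, every weight vector. -/
theorem zSplitII_of_pendantStar (p : E → R) (hp : IsProbVec p)
    (h : IsPendantStarAt ends o a₁ a₂ b u a₃ e₀ e₁ e₂ eo eb) : ZSplitII p ends o a₁ a₂ a₃ b :=
  zSplitII_of_leaf_markedStar p hp h.leaf h.ne_o' h.ne_a1' h.ne_a2' h.ne_b' h.markedStar

/-- **`(i)` for the pendant star in `G`.** -/
theorem zSplitI_of_pendantStar (p : E → R) (hp : IsProbVec p)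
    (h : IsPendantStarAt ends o a₁ a₂ b u a₃ e₀ e₁ e₂ eo eb) : ZSplitI p ends o a₁ a₂ a₃ b :=
  zSplitI_of_leaf_markedStar p hp h.leaf h.ne_o' h.ne_a1' h.ne_a2' h.ne_b' h.markedStar

/-- **`(J1₁)` for the pendant star in `G`.** -/
theorem jOneOne_of_pendantStar (p : E → R) (hp : IsProbVec p)
    (h : IsPendantStarAt ends o a₁ a₂ b u a₃ e₀ e₁ e₂ eo eb) : JOneOne p ends o a₁ a₂ a₃ b :=
  jOneOne_of_leaf_markedStar p hp h.leaf h.ne_o' h.ne_a1' h.ne_a2' h.ne_b' h.markedStar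

/-- **`(RV)` for the pendant star in `G`** (when the required-vertex world has mass). -/
theorem rv_of_pendantStar (p : E → R) (hp : IsProbVec p)
    (h : IsPendantStarAt ends o a₁ a₂ b u a₃ e₀ e₁ e₂ eo eb) (hT : 0 < prob p (Tp ends a₁ a₂ a₃)) :
    RV p ends o a₁ a₂ a₃ b :=
  (rv_iff_ii p ends o a₁ a₂ a₃ b hT).2 (zSplitII_of_pendantStar p hp h)

end PendantFive

end CaseOne

end Summit.Ventures.PercRepro2
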